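import Literature.Computability.Complexity.HiraharaSpec
import HarnessLib

/-!
# Hirahara's reduction: soundness on the constant-gap promise

Topic `Computability/Complexity`. Companion of `HiraharaSpec.lean` (the complete reduction
`HiraharaRed.redOut c I₀ r` of Hirahara's Thm. 8.5, `MCSP*` case, ECCC TR22-119, p. 31, with
Lemma 8.3, and its correctness on the promise of `gapCMMSA (Δ^α) (Δ^{-α}) sqrtLog`). The soundness
argument there uses of the no-promise only that the gap is at least the constant `107520` and the
soundness fraction is at most `1` (`HiraharaRed.Pre.heavy_of_no`) — as in the source, where
"`s · g ≤ K(y) ≤ O(s' log s')`, which implies `s' ≥ Ω(g) · s / log s`" beats `s_P = O(s / log s)` as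
soon as `g` exceeds a universal constant. This file records the resulting soundness of the SAME
reduction on the constant-gap promise `gapCMMSA g₀ ε₀ sqrtLog` (`g₀ ≥ 107520`, `ε₀ ≤ 1`), the
CMMSA problem that is NP-hard from gap label cover (Raz's theorem, Arora–Barak 2009, Thm. 22.15)
by the constant-parameter Dinur–Safra step (`CMMSAFromLabelCover.lean`): together with the
(promise-independent) completeness `HiraharaRed.redOut_mem_of_yes`, it is the mathematical content
of the hypothesis "Lemma 8.3 / Thm. 8.5 at a constant gap" of `isRandNPHard_MCSPStar_of_raz`.

## Main result

* `HiraharaRed.card_redOut_mem_mul_three_le_const` — for `c ≥ 1`, `g₀ ≥ 107520`, `ε₀ ≤ 1` and a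
  no-instance `I₀` of `gapCMMSA g₀ ε₀ sqrtLog`, at most a third of the coin strings of any length
  `m ≥ totCoins` have `redOut c I₀ r ∈ MCSP*`.

## References

* S. Hirahara, *NP-hardness of learning programs and partial MCSP*, ECCC TR22-119, proof of
  Thm. 8.5 (`MCSP*` case, p. 31) and Lemma 8.3 [Hirahara2022PartialMCSP].
-/

namespace Literature.Computability.Complexity

open Finset
open _root_.Computability
open Literature.Computability.MetaComplexity (MonotoneDNF MCSPStar sqrtLog CMMSAInstance boolFunEquivFin)
open Literature.Computability.MetaComplexity.CMMSA (yesSet noSet)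

namespace HiraharaRed

section RedConst

open scoped Classical

variable {c : ℕ} {I₀ : CMMSAInstance}

/-- **Soundness of the reduction on the constant-gap promise**: for `c ≥ 1` and constants
`g₀ ≥ 107520`, `ε₀ ≤ 1`, for a no-instance of `gapCMMSA g₀ ε₀ sqrtLog` (every assignment of weight
`≤ g₀ · s` satisfies fewer than `ε₀ · m` formulas), at most a third of the coin strings of any length
`m ≥ totCoins` are mapped into `MCSP*`. The proof is that of `card_redOut_mem_mul_three_le`
(`HiraharaSpec.lean`) verbatim, with the threshold `W₀ = ⌊g₀ θ⌋` in place of `⌊Δ(n)^α θ⌋`: that proof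
uses of the no-promise only `g(n) ≥ 107520` and `ε(n) ≤ 1` (`Pre.heavy_of_no`), as Hirahara's
("`s · g ≤ K(y) ≤ O(s' log s')` … implies `s' ≥ Ω(g) · s / log s`", against `s_P = O(s / log s)`: the
gap must exceed a universal constant). [cite: Hirahara2022PartialMCSP, proof of Thm. 8.5 (MCSP* case, p. 31), at a constant gap] -/
theorem card_redOut_mem_mul_three_le_const {g₀ ε₀ : ℝ} (hg₀ : (107520 : ℝ) ≤ g₀) (hε₀ : ε₀ ≤ 1)
    (hc : 1 ≤ c)
    (hno : I₀ ∈ noSet (fun _ => g₀) (fun _ => ε₀) sqrtLog)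
    {m : ℕ} (hm : (Pre.toPInst I₀).totCoins ≤ m) :
    ((univ : Finset (List.Vector Bool m)).filter fun r : List.Vector Bool m => redOut c I₀ r.toList ∈ MCSPStar).card * 3 ≤ 2 ^ m := by
  classical
  obtain ⟨hwf, hdeg, hnoa⟩ := hno
  -- consequences of the no-promise
  have hsatlt : ∀ a : ℕ → Bool, I₀.weightOf a ≤ I₀.threshold → ¬∀ φ ∈ I₀.formulas, φ.eval a = true := by
    intro a ha hall
    have hsc : I₀.satCount a = I₀.numFormulas := by
      unfold CMMSAInstance.satCount CMMSAInstance.numFormulas; rw [List.countP_eq_length]; exact hall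
    have hg1 : (1 : ℝ) ≤ g₀ := le_trans (by norm_num) hg₀
    have h := hnoa a (by
      calc (I₀.weightOf a : ℝ) ≤ I₀.threshold := by exact_mod_cast ha
        _ = 1 * I₀.threshold := (one_mul _).symm
        _ ≤ g₀ * I₀.threshold := by gcongr)
    rw [hsc] at h
    have : (I₀.numFormulas : ℝ) < I₀.numFormulas := by
      calc (I₀.numFormulas : ℝ) < ε₀ * I₀.numFormulas := h
        _ ≤ 1 * I₀.numFormulas := by gcongr
        _ = _ := one_mul _
    exact lt_irrefl _ this
  have hcount0 : ∀ {P : List.Vector Bool m → Prop} [DecidablePred P], (∀ r, ¬P r) →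
      ((univ : Finset (List.Vector Bool m)).filter P).card * 3 ≤ 2 ^ m := by
    intro P _ h
    rw [Finset.filter_false_of_mem fun r _ => h r]; simp
  -- rewriting the counted predicate through a pointwise description of `redOut`
  have hrw : ∀ {g : List Bool → List Bool}, (∀ r, redOut c I₀ r = g r) →
      ((univ : Finset (List.Vector Bool m)).filter fun r : List.Vector Bool m => redOut c I₀ r.toList ∈ MCSPStar) =
        (univ : Finset (List.Vector Bool m)).filter fun r : List.Vector Bool m => g r.toList ∈ MCSPStar := by
    intro g hg
    exact filter_congr fun r _ => by rw [hg]
  have hlen : ¬¬I₀.WellFormed := not_not.2 hwf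
  have hdg : ¬(sqrtLog I₀.numVars < I₀.degree) := not_lt.2 hdeg
  by_cases hnil : [] ∈ I₀.formulas
  · rw [hrw (g := fun _ => NO₀) fun r => by unfold redOut; rw [if_neg hlen, if_pos hnil]]
    exact hcount0 fun _ => NO₀_not_mem
  by_cases hW : Pre.totalW I₀ ≤ I₀.threshold
  · -- impossible: the all-true assignment is light and satisfies everything
    exfalso
    refine hsatlt (fun _ => true) ?_ fun φ hφ => ?_
    · unfold CMMSAInstance.weightOf
      simp only [if_true]
      exact hW
    · rw [MonotoneDNF.eval_eq_true_iff]
      obtain ⟨t, ht⟩ := List.exists_mem_of_ne_nil φ (fun h => hnil (h ▸ hφ))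
      exact ⟨t, ht, fun _ _ => rfl⟩
  by_cases hk : Pre.kept I₀ = []
  · -- impossible: the zero-weight assignment is light and satisfies everything
    exfalso
    have hall := Pre.eval_indicator_of_authorized (I₀ := I₀) (∅ : Finset (Fin I₀.numVars))
      (fun j => absurd j.isLt (by change ¬(j.val < (Pre.kept I₀).length); rw [hk]; simp))
    refine hsatlt _ ?_ hall
    rw [Pre.weightOf_indicator]; simp
  by_cases hθ0 : I₀.threshold = 0
  · rw [hrw (g := fun _ => NO₀) fun r => by unfold redOut; rw [if_neg hlen, if_neg hnil, if_neg hdg, if_neg hW, if_neg hk, if_pos hθ0]]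
    exact hcount0 fun _ => NO₀_not_mem
  by_cases hsmall : sqrtLog I₀.numVars < c
  · have hb : ¬(bruteYes I₀ = true) := by
      unfold bruteYes
      rw [decide_eq_true_iff]
      rintro ⟨S, hS, hSw, hSsat⟩
      refine hsatlt (fun v => decide (v ∈ S)) ?_ hSsat
      unfold CMMSAInstance.weightOf
      have hsub : S ⊆ Finset.range I₀.numVars := Finset.mem_powerset.1 hS
      calc ∑ i ∈ Finset.range I₀.numVars, (if decide (i ∈ S) = true then I₀.w i else 0)
          = ∑ i ∈ S, I₀.w i := by
            rw [← Finset.sum_filter]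
            congr 1
            ext i; simp only [mem_filter, Finset.mem_range, decide_eq_true_eq]
            exact ⟨fun h => h.2, fun h => ⟨Finset.mem_range.1 (hsub h), h⟩⟩
        _ ≤ I₀.threshold := hSw
    rw [hrw (g := fun _ => NO₀) fun r => by
      unfold redOut; rw [if_neg hlen, if_neg hnil, if_neg hdg, if_neg hW, if_neg hk, if_neg hθ0, if_pos hsmall, if_neg hb]]
    exact hcount0 fun _ => NO₀_not_mem
  -- the main construction
  rw [hrw (g := fun r => (Pre.toPInst I₀).output ((Pre.toPInst I₀).coinsOf r)) fun r => by
    unfold redOut; rw [if_neg hlen, if_neg hnil, if_neg hdg, if_neg hW, if_neg hk, if_neg hθ0, if_neg hsmall]]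
  have hcle : c ≤ sqrtLog I₀.numVars := not_lt.1 hsmall
  have h2 : 2 ≤ I₀.numVars := by
    have h1 : 1 ≤ sqrtLog I₀.numVars := le_trans hc hcle
    by_contra hlt
    have : sqrtLog I₀.numVars = 0 := by
      unfold MetaComplexity.sqrtLog
      interval_cases I₀.numVars <;> simp
    omega
  have hB := Pre.toPInst_big h2 hwf hdeg hnil (not_le.1 hW)
  set W₀ := ⌊g₀ * I₀.threshold⌋₊ with hW₀
  have hg0 : (0 : ℝ) ≤ g₀ := le_trans (by norm_num) hg₀
  have hν : 0 < (Pre.toPInst I₀).ν := by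
    change 0 < (Pre.kept I₀).length; exact List.length_pos_of_ne_nil hk
  have hNo := Pre.heavy_of_no (g := fun _ => g₀) (ε := fun _ => ε₀) ⟨hwf, hdeg, hnoa⟩ hε₀ hg0 hν
  have hW' : 107520 * (Pre.toPInst I₀).θ ≤ W₀ := by
    change 107520 * I₀.threshold ≤ W₀
    rw [hW₀]
    refine Nat.le_floor ?_
    push_cast
    have hθnn : (0 : ℝ) ≤ I₀.threshold := Nat.cast_nonneg _
    nlinarith
  have hmain := hB.card_output_mem_mul_three_le W₀ hW' hNo
  rw [PInst.card_coins] at hmain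
  rw [(Pre.toPInst I₀).card_filter_vector_eq hm (fun F => (Pre.toPInst I₀).output F ∈ MCSPStar)]
  calc 2 ^ (m - (Pre.toPInst I₀).totCoins) *
        ((univ : Finset (Coins (Pre.toPInst I₀).A)).filter fun F => (Pre.toPInst I₀).output F ∈ MCSPStar).card * 3
      = 2 ^ (m - (Pre.toPInst I₀).totCoins) *
          (((univ : Finset (Coins (Pre.toPInst I₀).A)).filter fun F => (Pre.toPInst I₀).output F ∈ MCSPStar).card * 3) := by ring
    _ ≤ 2 ^ (m - (Pre.toPInst I₀).totCoins) * 2 ^ (Pre.toPInst I₀).totCoins := Nat.mul_le_mul_left _ hmain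
    _ = 2 ^ m := by rw [← pow_add, Nat.sub_add_cancel hm]

end RedConst

end HiraharaRed

end Literature.Computability.Complexity
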